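import Summits.RiemannHypothesis.RiemannHypothesis.Theorems.WeilBochnerMeasurePlateau
import Mathlib.Analysis.SpecificLimits.Normed
import Literature.NumberTheory.LFunctions.WeilLineSupSampling
import HarnessLib

/-!
# RiemannHypothesis — growth of the Bochner–Kreĭn measure of a window: `μ[-T, T] = O(T log T)`

Helper file (`--supports stmt-RiemannHypothesis-0098`), RH-free, standard axioms.  Seat rh-explicit
weil-3 (structure).

Let `μ` be ANY positive measure on `ℝ` representing Weil's form on the window `[-b, b]`:
`‖ĝ(½+it)‖² ∈ L¹(μ)` and `W(g ⋆ g̃) = ∫ ‖ĝ(½+it)‖² dμ` for all tests `g` supported in `[-b, b]`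
(hypothesis `hμ` below, literally the conclusion of
`Literature.NumberTheory.LFunctions.WeilBochner.exists_measure_of_weilPositivityOn` from
`WeilPositivityOn b`; satisfied for every `b` by the zero-height measure under RH).  Testing the identity
against the smooth plateau `g_r` of width `r = 1/T` of `WeilBochnerMeasurePlateau.lean`
(`Re ĝ_r ≥ cos 1 · r` on `|t| ≤ T`, `Re Q(g_r) ≤ r (A + 8 log(1/r))`) gives

* `measure_Icc_le`: **`μ[-T, T] ≤ T (A + 8 log T) / cos²1` for all `T ≥ max(2/log 2, 1/b)`** — every
  representing measure has at most the Riemann–von Mangoldt order of growth `O(T log T)`;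
* `lintegral_inv_one_add_sq_lt_top`, `integrable_inv_one_add_sq`: **`∫ dμ(t)/(1 + t²) < ∞`**
  (dyadic shells), the input for extending the representation `Q = ∫ ‖·̂‖² dμ` from `C(b)` to Yoshida's
  window functions (jumps at `±b`, transforms decaying only like `1/|t|`);
* two elementary decay lemmas used there: `|t|‖ĝ(½+it)‖ ≤ ∫‖g′‖` (`abs_mul_norm_weilMellin_le`) and
  `‖z‖ ≤ P, |t|‖z‖ ≤ V ⇒ ‖z‖² ≤ 2 max(P², V²)(1+t²)⁻¹` (`sq_norm_le_of_le_of_abs_mul_le`).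
-/

noncomputable section

set_option linter.dupNamespace false  -- the mandated namespace repeats `RiemannHypothesis`

open Complex Filter Set MeasureTheory
open scoped Real Topology ContDiff ComplexConjugate
open Literature.NumberTheory.LFunctions

namespace Summit.RiemannHypothesis.RiemannHypothesis.Theorems.WeilBochnerMeasure

variable {b : ℝ} {μ : Measure ℝ}

/-! ## The growth law -/

/-- **Growth law: `μ[-T, T] = O(T log T)` for every representing measure.**  If `μ` represents Weil's
form on `[-b, b]` (`b > 0`) then there is `A ≥ 0` with
`μ [-T, T] ≤ T · (A + 8 log T) / cos²1` for every `T ≥ max (2/log 2) (1/b)`.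
(Plateau of width `r = 1/T`: `(cos 1 · r)² μ[-T, T] ≤ ∫ ‖ĝ_r‖² dμ = Re Q(g_r) ≤ r (A + 8 log T)`.) -/
theorem measure_Icc_le (hb : 0 < b)
    (hμ : ∀ g : ℝ → ℂ, IsWeilTest g → tsupport g ⊆ Icc (-b) b →
      Integrable (fun t : ℝ ↦ ‖weilMellin g (1 / 2 + t * I)‖ ^ 2) μ ∧
        weilQuadratic g = ((∫ t, ‖weilMellin g (1 / 2 + t * I)‖ ^ 2 ∂μ : ℝ) : ℂ)) :
    ∃ A : ℝ, 0 ≤ A ∧ ∀ T : ℝ, 2 / Real.log 2 ≤ T → 1 / b ≤ T →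
      μ (Icc (-T) T) ≤ ENNReal.ofReal (T * (A + 8 * Real.log T) / Real.cos 1 ^ 2) := by
  obtain ⟨L, hL0, hpl⟩ := exists_plateau
  obtain ⟨A, hA⟩ := re_weilQuadratic_plateau_le L
  have hlog2 : 0 < Real.log 2 := Real.log_pos one_lt_two
  have hcos : 0 < Real.cos 1 := Real.cos_pos_of_mem_Ioo ⟨by linarith [Real.pi_gt_three],
    by linarith [Real.pi_gt_three]⟩
  refine ⟨max A 0, le_max_right _ _, fun T hT1 hT2 ↦ ?_⟩
  have hT : 0 < T := lt_of_lt_of_le (by positivity) hT1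
  have hT1' : 1 ≤ T := by
    have : 1 ≤ 2 / Real.log 2 := by
      rw [le_div_iff₀ hlog2]; have := Real.log_two_lt_d9; linarith
    linarith
  set r : ℝ := 1 / T with hrdef
  have hr : 0 < r := by positivity
  have hr2 : r ≤ Real.log 2 / 2 := by
    rw [hrdef, div_le_iff₀ hT]
    have := (div_le_iff₀ hlog2).1 hT1
    linarith
  have hrb : r ≤ b := by
    rw [hrdef, div_le_iff₀ hT]
    have := (div_le_iff₀ hb).1 hT2
    linarith
  obtain ⟨η, hηs, hη01, hη1, hη0, hηL⟩ := hpl r hr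
  obtain ⟨hg, hgs⟩ := isWeilTest_plateau hηs hη0 hr
  set g : ℝ → ℂ := fun x ↦ ((η x : ℝ) : ℂ) with hgdef
  obtain ⟨hFi, hQ⟩ := hμ g hg (hgs.trans (Icc_subset_Icc (by linarith) hrb))
  set F : ℝ → ℝ := fun t ↦ ‖weilMellin g (1 / 2 + t * I)‖ ^ 2 with hF
  have hF0 : ∀ t, 0 ≤ F t := fun t ↦ by positivity
  -- upper bound `∫ F dμ = Re Q(g) ≤ r (A + 8 log T)`
  have hup : ∫ t, F t ∂μ ≤ r * (max A 0 + 8 * Real.log T) := by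
    have h1 : (weilQuadratic g).re = ∫ t, F t ∂μ := by rw [hQ, Complex.ofReal_re]
    have h2 := hA r hr hr2 η hηs hη01 hη0 hηL
    rw [h1, hrdef, one_div_one_div] at h2
    have h3 : r * (A + 8 * Real.log T) ≤ r * (max A 0 + 8 * Real.log T) := by
      gcongr; exact le_max_left _ _
    exact h2.trans (hrdef ▸ h3)
  -- lower bound `(cos 1 · r)² ≤ F` on `[-T, T]`
  have hlow : ∀ t ∈ Icc (-T) T, (Real.cos 1 * r) ^ 2 ≤ F t := by
    intro t ht
    have htr : |t| * r ≤ 1 := by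
      rw [hrdef, ← div_eq_mul_one_div, div_le_one hT, abs_le]; exact ht
    have h := re_weilMellin_plateau_ge hηs hη01 hη1 hη0 hr htr
    exact pow_le_pow_left₀ (by positivity) (h.trans (Complex.re_le_norm _)) 2
  -- `(cos 1 · r)² μ[-T,T] ≤ ∫ F dμ`
  set c : ENNReal := ENNReal.ofReal ((Real.cos 1 * r) ^ 2) with hc
  have hc0 : c ≠ 0 := (ENNReal.ofReal_pos.2 (by positivity)).ne'
  have hkey : c * μ (Icc (-T) T) ≤ ENNReal.ofReal (r * (max A 0 + 8 * Real.log T)) := by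
    calc c * μ (Icc (-T) T) = ∫⁻ t in Icc (-T) T, c ∂μ := (setLIntegral_const _ _).symm
      _ ≤ ∫⁻ t in Icc (-T) T, ENNReal.ofReal (F t) ∂μ :=
          setLIntegral_mono' measurableSet_Icc fun t ht ↦ ENNReal.ofReal_le_ofReal (hlow t ht)
      _ ≤ ∫⁻ t, ENNReal.ofReal (F t) ∂μ := setLIntegral_le_lintegral _ _
      _ = ENNReal.ofReal (∫ t, F t ∂μ) :=
          (ofReal_integral_eq_lintegral_ofReal hFi (ae_of_all _ hF0)).symm
      _ ≤ ENNReal.ofReal (r * (max A 0 + 8 * Real.log T)) := ENNReal.ofReal_le_ofReal hup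
  have hdiv : μ (Icc (-T) T) ≤ ENNReal.ofReal (r * (max A 0 + 8 * Real.log T)) / c := by
    rw [ENNReal.le_div_iff_mul_le (Or.inl hc0) (Or.inl ENNReal.ofReal_ne_top), mul_comm]
    exact hkey
  refine hdiv.trans (le_of_eq ?_)
  rw [hc, ← ENNReal.ofReal_div_of_pos (by positivity)]
  congr 1
  rw [hrdef]
  field_simp

/-! ## `∫ dμ/(1 + t²) < ∞` -/

/-- Dyadic shell bound: for `T₀ > 0` and every real `t`,
`(1 + t²)⁻¹ ≤ 𝟙_{[-T₀,T₀]}(t) + Σ_j (T₀ 2^j)⁻² 𝟙_{[-T₀ 2^{j+1}, T₀ 2^{j+1}]}(t)` (in `ℝ≥0∞`). -/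
theorem ofReal_inv_one_add_sq_le_shells {T₀ : ℝ} (hT₀ : 0 < T₀) (t : ℝ) :
    ENNReal.ofReal ((1 + t ^ 2)⁻¹) ≤
      (Icc (-T₀) T₀).indicator (fun _ ↦ (1 : ENNReal)) t +
        ∑' j : ℕ, ENNReal.ofReal (((T₀ * 2 ^ j) ^ 2)⁻¹) *
          (Icc (-(T₀ * 2 ^ (j + 1))) (T₀ * 2 ^ (j + 1))).indicator (fun _ ↦ (1 : ENNReal)) t := by
  by_cases ht : |t| ≤ T₀
  · have hmem : t ∈ Icc (-T₀) T₀ := by rw [mem_Icc, ← abs_le]; exact ht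
    rw [indicator_of_mem hmem]
    refine le_add_right ?_
    rw [← ENNReal.ofReal_one]
    exact ENNReal.ofReal_le_ofReal (inv_le_one_of_one_le₀ (by nlinarith))
  · rw [not_le] at ht
    -- the shell index `j`: least with `|t| ≤ T₀ 2^{j+1}`
    have hex : ∃ j : ℕ, |t| ≤ T₀ * 2 ^ (j + 1) := by
      obtain ⟨j, hj⟩ := pow_unbounded_of_one_lt (|t| / T₀) (by norm_num : (1 : ℝ) < 2)
      refine ⟨j, ?_⟩
      rw [div_lt_iff₀ hT₀] at hj
      calc |t| ≤ 2 ^ j * T₀ := hj.le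
        _ ≤ T₀ * 2 ^ (j + 1) := by rw [pow_succ, mul_comm]; nlinarith [pow_pos (two_pos : (0:ℝ) < 2) j]
    classical
    set j := Nat.find hex with hj
    have hj1 : |t| ≤ T₀ * 2 ^ (j + 1) := Nat.find_spec hex
    have hj2 : T₀ * 2 ^ j < |t| := by
      rcases Nat.eq_zero_or_pos j with h0 | hpos
      · rw [h0, pow_zero, mul_one]; exact ht
      · have hmin := Nat.find_min hex (m := j - 1) (by omega)
        rw [not_le] at hmin
        have e : j - 1 + 1 = j := by omega
        rwa [e] at hmin
    have hmem : t ∈ Icc (-(T₀ * 2 ^ (j + 1))) (T₀ * 2 ^ (j + 1)) := by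
      rw [mem_Icc, ← abs_le]; exact hj1
    have hpos : 0 < T₀ * 2 ^ j := by positivity
    calc ENNReal.ofReal ((1 + t ^ 2)⁻¹) ≤ ENNReal.ofReal (((T₀ * 2 ^ j) ^ 2)⁻¹) := by
          refine ENNReal.ofReal_le_ofReal (inv_anti₀ (by positivity) ?_)
          have : (T₀ * 2 ^ j) ^ 2 < |t| ^ 2 := by gcongr
          rw [sq_abs] at this
          linarith
      _ = ENNReal.ofReal (((T₀ * 2 ^ j) ^ 2)⁻¹) *
            (Icc (-(T₀ * 2 ^ (j + 1))) (T₀ * 2 ^ (j + 1))).indicator (fun _ ↦ (1 : ENNReal)) t := by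
          rw [indicator_of_mem hmem, mul_one]
      _ ≤ ∑' i : ℕ, ENNReal.ofReal (((T₀ * 2 ^ i) ^ 2)⁻¹) *
            (Icc (-(T₀ * 2 ^ (i + 1))) (T₀ * 2 ^ (i + 1))).indicator (fun _ ↦ (1 : ENNReal)) t :=
          ENNReal.le_tsum j
      _ ≤ _ := le_add_self

/-- **`∫ dμ(t)/(1 + t²) < ∞` for every representing measure** (growth law on dyadic shells:
`Σ_j (T₀2^j)⁻² · T₀2^{j+1}(A + 8 log(T₀2^{j+1})) < ∞`). -/
theorem lintegral_inv_one_add_sq_lt_top (hb : 0 < b)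
    (hμ : ∀ g : ℝ → ℂ, IsWeilTest g → tsupport g ⊆ Icc (-b) b →
      Integrable (fun t : ℝ ↦ ‖weilMellin g (1 / 2 + t * I)‖ ^ 2) μ ∧
        weilQuadratic g = ((∫ t, ‖weilMellin g (1 / 2 + t * I)‖ ^ 2 ∂μ : ℝ) : ℂ)) :
    ∫⁻ t, ENNReal.ofReal ((1 + t ^ 2)⁻¹) ∂μ < ⊤ := by
  obtain ⟨A, hA0, hA⟩ := measure_Icc_le hb hμ
  have hlog2 : 0 < Real.log 2 := Real.log_pos one_lt_two
  have hcos : 0 < Real.cos 1 := Real.cos_pos_of_mem_Ioo ⟨by linarith [Real.pi_gt_three],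
    by linarith [Real.pi_gt_three]⟩
  set T₀ : ℝ := max (2 / Real.log 2) (1 / b) with hT₀
  have hT₀1 : 1 ≤ T₀ := by
    have : 1 ≤ 2 / Real.log 2 := by
      rw [le_div_iff₀ hlog2]; have := Real.log_two_lt_d9; linarith
    exact this.trans (le_max_left _ _)
  have hT₀0 : 0 < T₀ := by linarith
  have hlogT₀ : 0 ≤ Real.log T₀ := Real.log_nonneg hT₀1
  -- growth on the shells
  set R : ℕ → ℝ := fun j ↦ T₀ * 2 ^ (j + 1) with hR
  have hRge : ∀ j, T₀ ≤ R j := fun j ↦ by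
    rw [hR]; exact le_mul_of_one_le_right hT₀0.le (one_le_pow₀ (by norm_num))
  have hμR : ∀ j, μ (Icc (-R j) (R j)) ≤ ENNReal.ofReal (R j * (A + 8 * Real.log (R j)) / Real.cos 1 ^ 2) :=
    fun j ↦ hA (R j) ((le_max_left _ _).trans (hRge j)) ((le_max_right _ _).trans (hRge j))
  have hμ0 : μ (Icc (-T₀) T₀) < ⊤ :=
    (hA T₀ (le_max_left _ _) (le_max_right _ _)).trans_lt ENNReal.ofReal_lt_top
  -- the real majorant series `a j = (T₀2^j)⁻² · R_j (A + 8 log R_j)/cos²1 = (2/(T₀ cos²1)) 2⁻ʲ (A + 8 log T₀ + 8(j+1) log 2)`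
  set a : ℕ → ℝ := fun j ↦ ((T₀ * 2 ^ j) ^ 2)⁻¹ * (R j * (A + 8 * Real.log (R j)) / Real.cos 1 ^ 2)
    with ha
  have hlogR : ∀ j : ℕ, Real.log (R j) = Real.log T₀ + (j + 1) * Real.log 2 := fun j ↦ by
    rw [hR]; simp only
    rw [Real.log_mul hT₀0.ne' (by positivity), Real.log_pow]; push_cast; ring
  have ha_eq : ∀ j : ℕ, a j = 2 / (T₀ * Real.cos 1 ^ 2) *
      ((A + 8 * Real.log T₀ + 8 * Real.log 2) * (1 / 2) ^ j + 8 * Real.log 2 * ((j : ℝ) ^ 1 * (1 / 2) ^ j)) := by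
    intro j
    simp only [ha]
    rw [hlogR]
    simp only [hR]
    have h2 : (2 : ℝ) ^ j ≠ 0 := pow_ne_zero _ two_ne_zero
    rw [show ((1 : ℝ) / 2) ^ j = (2 ^ j)⁻¹ by rw [one_div, inv_pow], pow_succ]
    field_simp
    ring
  have ha0 : ∀ j, 0 ≤ a j := fun j ↦ by
    simp only [ha, hR]
    refine mul_nonneg (by positivity) (div_nonneg (mul_nonneg (by positivity) ?_) (by positivity))
    rw [hlogR]; positivity
  have hsum : Summable a := by
    have h1 : Summable fun j : ℕ ↦ (1 / 2 : ℝ) ^ j := summable_geometric_of_lt_one (by norm_num) (by norm_num)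
    have h2 : Summable fun j : ℕ ↦ (j : ℝ) ^ 1 * (1 / 2 : ℝ) ^ j :=
      summable_pow_mul_geometric_of_norm_lt_one 1 (by rw [Real.norm_eq_abs, abs_of_pos (by norm_num)]; norm_num)
    have e : a = fun j : ℕ ↦ 2 / (T₀ * Real.cos 1 ^ 2) *
        ((A + 8 * Real.log T₀ + 8 * Real.log 2) * (1 / 2) ^ j + 8 * Real.log 2 * ((j : ℝ) ^ 1 * (1 / 2) ^ j)) :=
      funext ha_eq
    rw [e]
    exact ((h1.mul_left _).add (h2.mul_left _)).mul_left _
  -- measurability of the shells' majorant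
  have hmeas : ∀ j : ℕ, Measurable fun t : ℝ ↦ ENNReal.ofReal (((T₀ * 2 ^ j) ^ 2)⁻¹) *
      (Icc (-(T₀ * 2 ^ (j + 1))) (T₀ * 2 ^ (j + 1))).indicator (fun _ ↦ (1 : ENNReal)) t := fun j ↦
    (measurable_const.indicator measurableSet_Icc).const_mul _
  calc ∫⁻ t, ENNReal.ofReal ((1 + t ^ 2)⁻¹) ∂μ
      ≤ ∫⁻ t, (Icc (-T₀) T₀).indicator (fun _ ↦ (1 : ENNReal)) t +
          ∑' j : ℕ, ENNReal.ofReal (((T₀ * 2 ^ j) ^ 2)⁻¹) *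
            (Icc (-(T₀ * 2 ^ (j + 1))) (T₀ * 2 ^ (j + 1))).indicator (fun _ ↦ (1 : ENNReal)) t ∂μ :=
        lintegral_mono fun t ↦ ofReal_inv_one_add_sq_le_shells hT₀0 t
    _ = μ (Icc (-T₀) T₀) + ∑' j : ℕ, ENNReal.ofReal (((T₀ * 2 ^ j) ^ 2)⁻¹) * μ (Icc (-R j) (R j)) := by
        rw [lintegral_add_left (measurable_const.indicator measurableSet_Icc),
          lintegral_indicator_const measurableSet_Icc, one_mul,
          lintegral_tsum fun j ↦ (hmeas j).aemeasurable]
        congr 1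
        refine tsum_congr fun j ↦ ?_
        rw [lintegral_const_mul _ (measurable_const.indicator measurableSet_Icc),
          lintegral_indicator_const measurableSet_Icc, one_mul]
    _ ≤ μ (Icc (-T₀) T₀) + ∑' j : ℕ, ENNReal.ofReal (a j) := by
        gcongr with j
        simp only [ha]
        rw [ENNReal.ofReal_mul (by positivity)]
        gcongr
        exact hμR j
    _ = μ (Icc (-T₀) T₀) + ENNReal.ofReal (∑' j, a j) := by
        rw [ENNReal.ofReal_tsum_of_nonneg ha0 hsum]
    _ < ⊤ := ENNReal.add_lt_top.2 ⟨hμ0, ENNReal.ofReal_lt_top⟩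

/-- **`(1 + t²)⁻¹ ∈ L¹(μ)` for every measure representing a Weil-positive window.** -/
theorem integrable_inv_one_add_sq (hb : 0 < b)
    (hμ : ∀ g : ℝ → ℂ, IsWeilTest g → tsupport g ⊆ Icc (-b) b →
      Integrable (fun t : ℝ ↦ ‖weilMellin g (1 / 2 + t * I)‖ ^ 2) μ ∧
        weilQuadratic g = ((∫ t, ‖weilMellin g (1 / 2 + t * I)‖ ^ 2 ∂μ : ℝ) : ℂ)) :
    Integrable (fun t : ℝ ↦ (1 + t ^ 2)⁻¹) μ := by
  have hc : Continuous fun t : ℝ ↦ (1 + t ^ 2)⁻¹ :=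
    (continuous_const.add (continuous_pow 2)).inv₀ fun t ↦ (by positivity : (0 : ℝ) < 1 + t ^ 2).ne'
  refine ⟨hc.aestronglyMeasurable, ?_⟩
  rw [hasFiniteIntegral_iff_ofReal (ae_of_all _ fun t ↦ by positivity)]
  exact lintegral_inv_one_add_sq_lt_top hb hμ

/-! ## Decay of the transform from an `L¹` bound on the derivative -/

/-- `|t| · ‖ĝ(½+it)‖ ≤ ∫ ‖g′‖` for a test `g` (integration by parts `(g′)^(½+it) = −it·ĝ(½+it)` and
`‖(g′)^(½+it)‖ ≤ ∫ ‖g′‖`). -/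
theorem abs_mul_norm_weilMellin_le {g : ℝ → ℂ} (hg : IsWeilTest g) (t : ℝ) :
    |t| * ‖weilMellin g (1 / 2 + t * I)‖ ≤ ∫ x, ‖deriv g x‖ := by
  have h := norm_weilMellin_line_le_integral_norm hg.deriv.1.continuous hg.deriv.2 t
  rw [weilMellin_deriv hg, norm_mul] at h
  have e : ‖-((1 : ℂ) / 2 + t * I - 1 / 2)‖ = |t| := by
    rw [show -((1 : ℂ) / 2 + t * I - 1 / 2) = -(t * I) by ring, norm_neg, norm_mul, Complex.norm_real,
      Complex.norm_I, mul_one, Real.norm_eq_abs]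
  rwa [e] at h

/-- From `‖z‖ ≤ P` and `|t|‖z‖ ≤ V`: `‖z‖² ≤ 2 max(P², V²) (1+t²)⁻¹`. -/
theorem sq_norm_le_of_le_of_abs_mul_le {z : ℂ} {P V t : ℝ} (hP : ‖z‖ ≤ P) (hV : |t| * ‖z‖ ≤ V) :
    ‖z‖ ^ 2 ≤ 2 * max (P ^ 2) (V ^ 2) * (1 + t ^ 2)⁻¹ := by
  have h0 : 0 ≤ ‖z‖ := norm_nonneg _
  have hP2 : ‖z‖ ^ 2 ≤ P ^ 2 := pow_le_pow_left₀ h0 hP 2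
  have hV2 : t ^ 2 * ‖z‖ ^ 2 ≤ V ^ 2 := by
    have := pow_le_pow_left₀ (by positivity) hV 2
    rwa [mul_pow, sq_abs] at this
  rw [← div_eq_mul_inv, le_div_iff₀ (by positivity)]
  rcases le_or_gt (t ^ 2) 1 with ht | ht
  · calc ‖z‖ ^ 2 * (1 + t ^ 2) ≤ P ^ 2 * 2 := by nlinarith
      _ ≤ 2 * max (P ^ 2) (V ^ 2) := by linarith [le_max_left (P ^ 2) (V ^ 2)]
  · calc ‖z‖ ^ 2 * (1 + t ^ 2) ≤ 2 * (t ^ 2 * ‖z‖ ^ 2) := by nlinarith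
      _ ≤ 2 * max (P ^ 2) (V ^ 2) := by linarith [le_max_right (P ^ 2) (V ^ 2)]

end Summit.RiemannHypothesis.RiemannHypothesis.Theorems.WeilBochnerMeasure

end
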